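import Summits.MatrixMultiplication.MatrixMultiplication.Theses.CondensationDistance

/-!
# Crux `ShortCondensation` (stmt-MatrixMultiplication-15936) — `Lines/birth.lean`, the BC3 birth skeleton

Route `CondensationDistance` (route-MatrixMultiplication-CondensationDistance; deciding theorem
`closes : ShortCondensation → CondensationSound → DerivationsBoundOmega → MatrixMultiplication`, proved
in the route file).  The crux, in the route's combinatorial model (maximal minors of `[I_n | Z]` as
points of the Johnson scheme; ONE step lists an `n`-set `J` justified by an octahedron
`{J−p+u, J−p+v, J−q+u, J−q+v, J−p−q+u+v}` all of whose members are in the radius-1 ball around `[n]`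
or listed earlier — the short (three-term) Plücker relation):

  `ShortCondensation : ∀ ε > 0, ∃ c n₀, ∀ n ≥ n₀, ∃ m', n ≤ m' ≤ n ^ c ∧ (a valid derivation of length
     ≤ n^(2+ε) in J(n+m', n) listing the target {n ≤ x < 2n})`.

## The line: Sylvester/Bareiss frame transport + sub-scheme recursion (the route header's own plan)

The route header feeds `X = ShortCondensation` from its stronger cruxes along
`CheapHalfTransport → TightCondensation → ShortCondensation` (support items `TransportToTight`,
`TightToShort`).  This skeleton kernel-checks that plan and cuts it at its natural joints:

* `stub_cheapHalfTransport` — **the engine** (verbatim the route's crux `CheapHalfTransport`,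
  stmt-MatrixMultiplication-15938, rank 4; `Iff.rfl` below): for every `ε > 0` and all large `n` a valid
  derivation of length `≤ n^(2+ε)` in `J(2n,n)` after which the whole radius-1 ball around the core set
  `H = {n/2 ≤ x < n + n/2}` (the Bareiss frame at stage `n/2`) is known.  Size XL / open.
* `stub_transportStep` — **single-scale sub-scheme transport** (the combinatorial heart of the support
  item `TransportToTight`, with NO asymptotics): for `k + n' = n`, a valid derivation `f₁` in `J(2n,n)`
  after which the ball around `H_k = {k ≤ x < n + k}` is known, followed by the lift
  `J' ↦ [n, n+k) ∪ e(J')` (`e` = the order embedding of `[k,n) ⊔ [n+k,2n)`) of a valid derivation `f₂`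
  of `J(2n',n')` listing its target, is a valid derivation of `J(2n,n)` of length `≤ l₁ + l₂` listing
  the target `{n ≤ x}`: the `n`-sets containing the core columns `[n,n+k)` and avoiding the core rows
  `[0,k)` form a copy of `J(2n',n')` with base `H_k`, the same target, initial ball inside the ball
  around `H_k`, and octahedra that are octahedra of `J(2n,n)`.  Size M (true; index bookkeeping over
  `Fin`-indexed sequences and `Finset` images).
* `stub_dodgsonExists` — **qualitative Dodgson condensation** (the recursion floor): for every `n ≥ 2`
  there is SOME valid derivation in `J(2n,n)` listing the target, of length `≤ n ^ 3` (Dodgson 1867 /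
  Desnanot–Jacobi: list the contiguous minors by size, `Σ_{k<n} k² ≤ n³` steps; each step is the
  octahedron `p, q` = extreme columns, `u, v` = extreme rows).  Size M (true).  Needed because the
  closure distance is INFINITE at `n = 1` (no octahedron exists), so the recursion
  `D(n) ≤ T(n) + D(⌈n/2⌉)` must bottom out on explicit derivations at the finitely many sizes below the
  engine's threshold `n₀(ε)`, which is not explicit.
* `TightCondensation_of : <stub₁-sig> → <stub₂-sig> → <stub₃-sig> → TightCondensation` — PROVED here
  (the quantitative recursion: strong induction on `n` with the bound `N³ + 2·n^(2+ε/2)`, using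
  `⌈n/2⌉ ≤ 2n/3` for `n ≥ 3` and `(2/3)^(2+ε/2) ≤ 4/9`, then `N³ + 2·n^(2+ε/2) ≤ n^(2+ε)` eventually).
* `TransportToTight_of : <stub₂-sig> → <stub₃-sig> → TransportToTight` — PROVED here (the support item
  stmt-MatrixMultiplication-15943 by name costs exactly the two true combinatorial stubs).
* `TightToShort_holds : TightToShort` (= `TightCondensation → ShortCondensation`, the support item
  stmt-MatrixMultiplication-15942, by name) — PROVED here (`m' = n`, `c = 1`; the two targets coincide
  since `x < n + n = 2n` on `Fin (n + n)`); a prover may lift it verbatim into `Theorems/`.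
* `ShortCondensation_of : <stub₁-sig> → <stub₂-sig> → <stub₃-sig> → ShortCondensation` — THE skeleton
  theorem, the crux BY NAME, sorry-free; `ShortCondensation_of_stubs` feeds it the declared stubs.

Sorries: exactly three, one inside each `stub_*`; zero elsewhere.
-/

-- `Summit.<Summit>.<Problem>`: for the single-conjunct summit the duplicate component is mandated.
set_option linter.dupNamespace false

namespace Summit.MatrixMultiplication.MatrixMultiplication.Cruxes.ShortCondensation.Birth

open scoped BigOperators Classical
open Summit.MatrixMultiplication.MatrixMultiplication.Theses.CondensationDistance

/-! ## The three registered stubs -/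

/-- **Stub 1 — the engine: cheap transport of the Bareiss half-frame** (verbatim the route's crux
`CheapHalfTransport`, stmt-MatrixMultiplication-15938): for every `ε > 0` and all large `n` there is a
valid derivation of length `≤ n^(2+ε)` in `J(2n,n)` from the radius-1 ball around `[n]` after which every
`n`-set within distance `1` of the core set `H = {n/2 ≤ x < n + n/2}` is in the initial ball or listed.
Size XL / open-problem (why it might fail, inherited: moving the frame by unit Johnson steps renews
`~n²` sets per step; no amortised scheme is known).  Sources: Bareiss1968,
BerensteinFominZelevinsky1996, OhPostnikovSpeyer2011. -/
theorem stub_cheapHalfTransport :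
    ∀ ε : ℝ, 0 < ε → ∃ n₀ : ℕ, ∀ n ≥ n₀, ∃ (l : ℕ) (f : Fin l → Finset (Fin (n + n))), (l : ℝ) ≤ (n : ℝ) ^ (2 + ε) ∧ (∀ i : Fin l, ∃ p ∈ f i, ∃ q ∈ f i, p ≠ q ∧ ∃ u ∉ f i, ∃ v ∉ f i, u ≠ v ∧ ∀ J ∈ [insert u ((f i).erase p), insert v ((f i).erase p), insert u ((f i).erase q), insert v ((f i).erase q), insert u (insert v (((f i).erase p).erase q))], (J.card = n ∧ (J.filter fun x : Fin (n + n) => n ≤ x.val).card ≤ 1) ∨ ∃ j : Fin l, j < i ∧ f j = J) ∧ ∀ J : Finset (Fin (n + n)), J.card = n → (J \ (Finset.univ.filter fun x : Fin (n + n) => n / 2 ≤ x.val ∧ x.val < n + n / 2)).card ≤ 1 → (J.card = n ∧ (J.filter fun x : Fin (n + n) => n ≤ x.val).card ≤ 1) ∨ ∃ i : Fin l, f i = J := by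
  sorry

/-- **Stub 2 — single-scale sub-scheme transport** (the combinatorial content of the support item
`TransportToTight`, stmt-MatrixMultiplication-15943, one scale, no asymptotics): if `k + n' = n`, `f₁` is a
valid derivation in `J(2n,n)` after which the radius-1 ball around `H_k = {k ≤ x < n + k}` is known, and
`f₂` is a valid derivation in `J(2n',n')` listing its target `{n' ≤ x}`, then some valid derivation in
`J(2n,n)` of length `≤ l₁ + l₂` lists the target `{n ≤ x}` (namely `f₁` followed by
`i ↦ [n, n+k) ∪ e (f₂ i)`, `e x = x + k` for `x < n'`, `e x = x + 2k` otherwise).  Size M; true.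
Sources: Bareiss1968 (Sylvester identity / bordered minors), BurgisserClausenShokrollahi1997. -/
theorem stub_transportStep :
    ∀ (n k n' : ℕ), k + n' = n →
    ∀ (l₁ : ℕ) (f₁ : Fin l₁ → Finset (Fin (n + n))) (l₂ : ℕ) (f₂ : Fin l₂ → Finset (Fin (n' + n'))),
      (∀ i : Fin l₁, ∃ p ∈ f₁ i, ∃ q ∈ f₁ i, p ≠ q ∧ ∃ u ∉ f₁ i, ∃ v ∉ f₁ i, u ≠ v ∧ ∀ J ∈ [insert u ((f₁ i).erase p), insert v ((f₁ i).erase p), insert u ((f₁ i).erase q), insert v ((f₁ i).erase q), insert u (insert v (((f₁ i).erase p).erase q))], (J.card = n ∧ (J.filter fun x : Fin (n + n) => n ≤ x.val).card ≤ 1) ∨ ∃ j : Fin l₁, j < i ∧ f₁ j = J) →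
      (∀ J : Finset (Fin (n + n)), J.card = n → (J \ (Finset.univ.filter fun x : Fin (n + n) => k ≤ x.val ∧ x.val < n + k)).card ≤ 1 → (J.card = n ∧ (J.filter fun x : Fin (n + n) => n ≤ x.val).card ≤ 1) ∨ ∃ i : Fin l₁, f₁ i = J) →
      (∀ i : Fin l₂, ∃ p ∈ f₂ i, ∃ q ∈ f₂ i, p ≠ q ∧ ∃ u ∉ f₂ i, ∃ v ∉ f₂ i, u ≠ v ∧ ∀ J ∈ [insert u ((f₂ i).erase p), insert v ((f₂ i).erase p), insert u ((f₂ i).erase q), insert v ((f₂ i).erase q), insert u (insert v (((f₂ i).erase p).erase q))], (J.card = n' ∧ (J.filter fun x : Fin (n' + n') => n' ≤ x.val).card ≤ 1) ∨ ∃ j : Fin l₂, j < i ∧ f₂ j = J) →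
      (∃ i : Fin l₂, f₂ i = Finset.univ.filter fun x : Fin (n' + n') => n' ≤ x.val) →
      ∃ (l : ℕ) (f : Fin l → Finset (Fin (n + n))), l ≤ l₁ + l₂ ∧
        (∀ i : Fin l, ∃ p ∈ f i, ∃ q ∈ f i, p ≠ q ∧ ∃ u ∉ f i, ∃ v ∉ f i, u ≠ v ∧ ∀ J ∈ [insert u ((f i).erase p), insert v ((f i).erase p), insert u ((f i).erase q), insert v ((f i).erase q), insert u (insert v (((f i).erase p).erase q))], (J.card = n ∧ (J.filter fun x : Fin (n + n) => n ≤ x.val).card ≤ 1) ∨ ∃ j : Fin l, j < i ∧ f j = J) ∧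
        ∃ i : Fin l, f i = Finset.univ.filter fun x : Fin (n + n) => n ≤ x.val := by
  sorry

/-- **Stub 3 — qualitative Dodgson condensation** (the recursion floor): for every `n ≥ 2` some valid
derivation in `J(2n,n)` of length `≤ n³` lists the target `{n ≤ x}` — Dodgson's condensation read as a
monotone derivation: list the contiguous `h × h` minors for `h = 2, …, n` (`Σ_{h} (n−h+1)² ≤ n³` steps),
each justified by the Desnanot–Jacobi octahedron (`p, q` the extreme columns of the minor, `u, v` its
extreme rows; the five mates are contiguous minors of sizes `h−1` (four) and `h−2`, i.e. entries / `1`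
or listed earlier).  Size M; true.  (At `n = 1` NO derivation exists — the refuter's `decide` — so a
floor hypothesis of this kind is unavoidable.)  Sources: Dodgson1867, Bareiss1968,
FallatJohnson2011 (§1.2, the short Plücker relation). -/
theorem stub_dodgsonExists :
    ∀ n : ℕ, 2 ≤ n → ∃ (l : ℕ) (f : Fin l → Finset (Fin (n + n))), l ≤ n ^ 3 ∧
      (∀ i : Fin l, ∃ p ∈ f i, ∃ q ∈ f i, p ≠ q ∧ ∃ u ∉ f i, ∃ v ∉ f i, u ≠ v ∧ ∀ J ∈ [insert u ((f i).erase p), insert v ((f i).erase p), insert u ((f i).erase q), insert v ((f i).erase q), insert u (insert v (((f i).erase p).erase q))], (J.card = n ∧ (J.filter fun x : Fin (n + n) => n ≤ x.val).card ≤ 1) ∨ ∃ j : Fin l, j < i ∧ f j = J) ∧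
      ∃ i : Fin l, f i = Finset.univ.filter fun x : Fin (n + n) => n ≤ x.val := by
  sorry

/-! ## Sorry-free core -/

/-- Stub 1 is the route's crux `CheapHalfTransport` (stmt-MatrixMultiplication-15938), definitionally.
[folklore] -/
example :
    (∀ ε : ℝ, 0 < ε → ∃ n₀ : ℕ, ∀ n ≥ n₀, ∃ (l : ℕ) (f : Fin l → Finset (Fin (n + n))), (l : ℝ) ≤ (n : ℝ) ^ (2 + ε) ∧ (∀ i : Fin l, ∃ p ∈ f i, ∃ q ∈ f i, p ≠ q ∧ ∃ u ∉ f i, ∃ v ∉ f i, u ≠ v ∧ ∀ J ∈ [insert u ((f i).erase p), insert v ((f i).erase p), insert u ((f i).erase q), insert v ((f i).erase q), insert u (insert v (((f i).erase p).erase q))], (J.card = n ∧ (J.filter fun x : Fin (n + n) => n ≤ x.val).card ≤ 1) ∨ ∃ j : Fin l, j < i ∧ f j = J) ∧ ∀ J : Finset (Fin (n + n)), J.card = n → (J \ (Finset.univ.filter fun x : Fin (n + n) => n / 2 ≤ x.val ∧ x.val < n + n / 2)).card ≤ 1 → (J.card = n ∧ (J.filter fun x : Fin (n + n) => n ≤ x.val).card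 ≤ 1) ∨ ∃ i : Fin l, f i = J)
    ↔ CheapHalfTransport :=
  Iff.rfl

/-- **The quantitative recursion (proved).** From the three stub STATEMENTS: `TightCondensation`
(stmt-MatrixMultiplication-15937) — `D(n) ≤ T(n) + D(⌈n/2⌉)` iterated down to the floor, geometric sum.
In particular stubs 2 and 3 alone prove the support item `TransportToTight`. [folklore] -/
theorem TightCondensation_of
    (h₁ : ∀ ε : ℝ, 0 < ε → ∃ n₀ : ℕ, ∀ n ≥ n₀, ∃ (l : ℕ) (f : Fin l → Finset (Fin (n + n))), (l : ℝ) ≤ (n : ℝ) ^ (2 + ε) ∧ (∀ i : Fin l, ∃ p ∈ f i, ∃ q ∈ f i, p ≠ q ∧ ∃ u ∉ f i, ∃ v ∉ f i, u ≠ v ∧ ∀ J ∈ [insert u ((f i).erase p), insert v ((f i).erase p), insert u ((f i).erase q), insert v ((f i).erase q), insert u (insert v (((f i).erase p).erase q))], (J.card = n ∧ (J.filter fun x : Fin (n + n) => n ≤ x.val).card ≤ 1) ∨ ∃ j : Fin l, j < i ∧ f j = J) ∧ ∀ J : Finset (Fin (n + n)), J.card = n → (J \ (Finset.univ.filter fun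 x : Fin (n + n) => n / 2 ≤ x.val ∧ x.val < n + n / 2)).card ≤ 1 → (J.card = n ∧ (J.filter fun x : Fin (n + n) => n ≤ x.val).card ≤ 1) ∨ ∃ i : Fin l, f i = J)
    (h₂ : ∀ (n k n' : ℕ), k + n' = n →
      ∀ (l₁ : ℕ) (f₁ : Fin l₁ → Finset (Fin (n + n))) (l₂ : ℕ) (f₂ : Fin l₂ → Finset (Fin (n' + n'))),
      (∀ i : Fin l₁, ∃ p ∈ f₁ i, ∃ q ∈ f₁ i, p ≠ q ∧ ∃ u ∉ f₁ i, ∃ v ∉ f₁ i, u ≠ v ∧ ∀ J ∈ [insert u ((f₁ i).erase p), insert v ((f₁ i).erase p), insert u ((f₁ i).erase q), insert v ((f₁ i).erase q), insert u (insert v (((f₁ i).erase p).erase q))], (J.card = n ∧ (J.filter fun x : Fin (n + n) => n ≤ x.val).card ≤ 1) ∨ ∃ j : Fin l₁, j < i ∧ f₁ j = J) →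
      (∀ J : Finset (Fin (n + n)), J.card = n → (J \ (Finset.univ.filter fun x : Fin (n + n) => k ≤ x.val ∧ x.val < n + k)).card ≤ 1 → (J.card = n ∧ (J.filter fun x : Fin (n + n) => n ≤ x.val).card ≤ 1) ∨ ∃ i : Fin l₁, f₁ i = J) →
      (∀ i : Fin l₂, ∃ p ∈ f₂ i, ∃ q ∈ f₂ i, p ≠ q ∧ ∃ u ∉ f₂ i, ∃ v ∉ f₂ i, u ≠ v ∧ ∀ J ∈ [insert u ((f₂ i).erase p), insert v ((f₂ i).erase p), insert u ((f₂ i).erase q), insert v ((f₂ i).erase q), insert u (insert v (((f₂ i).erase p).erase q))], (J.card = n' ∧ (J.filter fun x : Fin (n' + n') => n' ≤ x.val).card ≤ 1) ∨ ∃ j : Fin l₂, j < i ∧ f₂ j = J) →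
      (∃ i : Fin l₂, f₂ i = Finset.univ.filter fun x : Fin (n' + n') => n' ≤ x.val) →
      ∃ (l : ℕ) (f : Fin l → Finset (Fin (n + n))), l ≤ l₁ + l₂ ∧
        (∀ i : Fin l, ∃ p ∈ f i, ∃ q ∈ f i, p ≠ q ∧ ∃ u ∉ f i, ∃ v ∉ f i, u ≠ v ∧ ∀ J ∈ [insert u ((f i).erase p), insert v ((f i).erase p), insert u ((f i).erase q), insert v ((f i).erase q), insert u (insert v (((f i).erase p).erase q))], (J.card = n ∧ (J.filter fun x : Fin (n + n) => n ≤ x.val).card ≤ 1) ∨ ∃ j : Fin l, j < i ∧ f j = J) ∧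
        ∃ i : Fin l, f i = Finset.univ.filter fun x : Fin (n + n) => n ≤ x.val)
    (h₃ : ∀ n : ℕ, 2 ≤ n → ∃ (l : ℕ) (f : Fin l → Finset (Fin (n + n))), l ≤ n ^ 3 ∧
      (∀ i : Fin l, ∃ p ∈ f i, ∃ q ∈ f i, p ≠ q ∧ ∃ u ∉ f i, ∃ v ∉ f i, u ≠ v ∧ ∀ J ∈ [insert u ((f i).erase p), insert v ((f i).erase p), insert u ((f i).erase q), insert v ((f i).erase q), insert u (insert v (((f i).erase p).erase q))], (J.card = n ∧ (J.filter fun x : Fin (n + n) => n ≤ x.val).card ≤ 1) ∨ ∃ j : Fin l, j < i ∧ f j = J) ∧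
      ∃ i : Fin l, f i = Finset.univ.filter fun x : Fin (n + n) => n ≤ x.val) :
    TightCondensation := by
  intro ε hε
  have hε2 : 0 < ε / 2 := half_pos hε
  obtain ⟨n₀, hn₀⟩ := h₁ (ε / 2) hε2
  -- the floor threshold `N ≥ n₀, 3`
  obtain ⟨N, hNn₀, hN3⟩ : ∃ N : ℕ, n₀ ≤ N ∧ 3 ≤ N := ⟨max n₀ 3, le_max_left _ _, le_max_right _ _⟩
  -- KEY RECURSION: every `n ≥ 2` has a valid derivation listing the target of length
  -- `≤ N³ + 2·n^(2+ε/2)` (floor below `N`, engine + transport + induction above).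
  have key : ∀ n : ℕ, 2 ≤ n → ∃ (l : ℕ) (f : Fin l → Finset (Fin (n + n))),
      (∀ i : Fin l, ∃ p ∈ f i, ∃ q ∈ f i, p ≠ q ∧ ∃ u ∉ f i, ∃ v ∉ f i, u ≠ v ∧ ∀ J ∈ [insert u ((f i).erase p), insert v ((f i).erase p), insert u ((f i).erase q), insert v ((f i).erase q), insert u (insert v (((f i).erase p).erase q))], (J.card = n ∧ (J.filter fun x : Fin (n + n) => n ≤ x.val).card ≤ 1) ∨ ∃ j : Fin l, j < i ∧ f j = J) ∧
      (∃ i : Fin l, f i = Finset.univ.filter fun x : Fin (n + n) => n ≤ x.val) ∧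
      (l : ℝ) ≤ (N : ℝ) ^ (3 : ℕ) + 2 * (n : ℝ) ^ (2 + ε / 2) := by
    intro n
    induction n using Nat.strong_induction_on with
    | _ n ih =>
      intro h2n
      rcases Nat.lt_or_ge n N with hlt | hge
      · -- floor: an explicit (Dodgson) derivation of length ≤ n³ ≤ N³
        obtain ⟨l, f, hl, hv, ht⟩ := h₃ n h2n
        refine ⟨l, f, hv, ht, ?_⟩
        have hlN : (l : ℝ) ≤ (N : ℝ) ^ (3 : ℕ) := by
          have h : l ≤ N ^ 3 := hl.trans (Nat.pow_le_pow_left hlt.le 3)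
          exact_mod_cast h
        have h0 : (0 : ℝ) ≤ 2 * (n : ℝ) ^ (2 + ε / 2) := by positivity
        linarith
      · -- engine at scale `n`, transport, recursive call at `n' = n - n / 2 = ⌈n/2⌉`
        have hn₀n : n₀ ≤ n := hNn₀.trans hge
        have h3n : 3 ≤ n := hN3.trans hge
        obtain ⟨l₁, f₁, hl₁, hv₁, hk₁⟩ := hn₀ n hn₀n
        have hlt' : n - n / 2 < n := by omega
        have h2n' : 2 ≤ n - n / 2 := by omega
        obtain ⟨l₂, f₂, hv₂, ht₂, hl₂⟩ := ih (n - n / 2) hlt' h2n'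
        obtain ⟨l, f, hl, hv, ht⟩ :=
          h₂ n (n / 2) (n - n / 2) (by omega) l₁ f₁ l₂ f₂ hv₁ hk₁ hv₂ ht₂
        refine ⟨l, f, hv, ht, ?_⟩
        have hcast : (l : ℝ) ≤ (l₁ : ℝ) + (l₂ : ℝ) := by exact_mod_cast hl
        have hn' : ((n - n / 2 : ℕ) : ℝ) ≤ 2 / 3 * (n : ℝ) := by
          have h : 3 * (n - n / 2) ≤ 2 * n := by omega
          have h' : (3 : ℝ) * ((n - n / 2 : ℕ) : ℝ) ≤ 2 * (n : ℝ) := by exact_mod_cast h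
          linarith
        have hs : (0 : ℝ) ≤ 2 + ε / 2 := by linarith
        have h49 : (2 / 3 : ℝ) ^ (2 + ε / 2) ≤ 4 / 9 :=
          calc (2 / 3 : ℝ) ^ (2 + ε / 2) ≤ (2 / 3 : ℝ) ^ (2 : ℝ) :=
                Real.rpow_le_rpow_of_exponent_ge (by norm_num) (by norm_num) (by linarith)
            _ = 4 / 9 := by rw [Real.rpow_two]; norm_num
        have hpow : ((n - n / 2 : ℕ) : ℝ) ^ (2 + ε / 2) ≤ 4 / 9 * (n : ℝ) ^ (2 + ε / 2) :=
          calc ((n - n / 2 : ℕ) : ℝ) ^ (2 + ε / 2)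
              ≤ (2 / 3 * (n : ℝ)) ^ (2 + ε / 2) := Real.rpow_le_rpow (by positivity) hn' hs
            _ = (2 / 3 : ℝ) ^ (2 + ε / 2) * (n : ℝ) ^ (2 + ε / 2) :=
                Real.mul_rpow (by norm_num) (by positivity)
            _ ≤ 4 / 9 * (n : ℝ) ^ (2 + ε / 2) :=
                mul_le_mul_of_nonneg_right h49 (by positivity)
        have h0 : (0 : ℝ) ≤ (n : ℝ) ^ (2 + ε / 2) := by positivity
        linarith
  -- THRESHOLD: `N³ + 2·n^(2+ε/2) ≤ n^(2+ε)` as soon as `n^(ε/2) ≥ N³ + 2`.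
  have hev : ∀ᶠ n : ℕ in Filter.atTop, (N : ℝ) ^ (3 : ℕ) + 2 ≤ (n : ℝ) ^ (ε / 2) :=
    ((tendsto_rpow_atTop hε2).comp tendsto_natCast_atTop_atTop).eventually_ge_atTop _
  obtain ⟨n₁, hn₁⟩ := Filter.eventually_atTop.1 hev
  refine ⟨max n₁ 2, fun n hn => ?_⟩
  have hn1 : n₁ ≤ n := le_trans (le_max_left _ _) hn
  have hn2 : 2 ≤ n := le_trans (le_max_right _ _) hn
  obtain ⟨l, f, hv, ht, hl⟩ := key n hn2
  refine ⟨l, f, ?_, hv, ht⟩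
  have hnpos : (0 : ℝ) < n := by exact_mod_cast (show 0 < n by omega)
  have h1n : (1 : ℝ) ≤ n := by exact_mod_cast (show 1 ≤ n by omega)
  have hA : (1 : ℝ) ≤ (n : ℝ) ^ (2 + ε / 2) := Real.one_le_rpow h1n (by linarith)
  have hB : (N : ℝ) ^ (3 : ℕ) + 2 ≤ (n : ℝ) ^ (ε / 2) := hn₁ n hn1
  have hsplit : (n : ℝ) ^ (2 + ε) = (n : ℝ) ^ (2 + ε / 2) * (n : ℝ) ^ (ε / 2) := by
    rw [← Real.rpow_add hnpos]; congr 1; ring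
  rw [hsplit]
  have hN0 : (0 : ℝ) ≤ (N : ℝ) ^ (3 : ℕ) := by positivity
  have hstep1 : (n : ℝ) ^ (2 + ε / 2) * ((N : ℝ) ^ (3 : ℕ) + 2) ≤
      (n : ℝ) ^ (2 + ε / 2) * (n : ℝ) ^ (ε / 2) :=
    mul_le_mul_of_nonneg_left hB (by positivity)
  have hstep2 : (N : ℝ) ^ (3 : ℕ) ≤ (n : ℝ) ^ (2 + ε / 2) * (N : ℝ) ^ (3 : ℕ) :=
    le_mul_of_one_le_left hN0 hA
  linarith

/-- **`TransportToTight` (support item stmt-MatrixMultiplication-15943, `CheapHalfTransport → TightCondensation`)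
from stubs 2 and 3 alone, BY NAME**: the engine hypothesis of `TightCondensation_of` is the route's
`CheapHalfTransport` definitionally, so the two true combinatorial stubs are exactly what the support item
costs. [folklore] -/
theorem TransportToTight_of
    (h₂ : ∀ (n k n' : ℕ), k + n' = n →
      ∀ (l₁ : ℕ) (f₁ : Fin l₁ → Finset (Fin (n + n))) (l₂ : ℕ) (f₂ : Fin l₂ → Finset (Fin (n' + n'))),
      (∀ i : Fin l₁, ∃ p ∈ f₁ i, ∃ q ∈ f₁ i, p ≠ q ∧ ∃ u ∉ f₁ i, ∃ v ∉ f₁ i, u ≠ v ∧ ∀ J ∈ [insert u ((f₁ i).erase p), insert v ((f₁ i).erase p), insert u ((f₁ i).erase q), insert v ((f₁ i).erase q), insert u (insert v (((f₁ i).erase p).erase q))], (J.card = n ∧ (J.filter fun x : Fin (n + n) => n ≤ x.val).card ≤ 1) ∨ ∃ j : Fin l₁, j < i ∧ f₁ j = J) →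
      (∀ J : Finset (Fin (n + n)), J.card = n → (J \ (Finset.univ.filter fun x : Fin (n + n) => k ≤ x.val ∧ x.val < n + k)).card ≤ 1 → (J.card = n ∧ (J.filter fun x : Fin (n + n) => n ≤ x.val).card ≤ 1) ∨ ∃ i : Fin l₁, f₁ i = J) →
      (∀ i : Fin l₂, ∃ p ∈ f₂ i, ∃ q ∈ f₂ i, p ≠ q ∧ ∃ u ∉ f₂ i, ∃ v ∉ f₂ i, u ≠ v ∧ ∀ J ∈ [insert u ((f₂ i).erase p), insert v ((f₂ i).erase p), insert u ((f₂ i).erase q), insert v ((f₂ i).erase q), insert u (insert v (((f₂ i).erase p).erase q))], (J.card = n' ∧ (J.filter fun x : Fin (n' + n') => n' ≤ x.val).card ≤ 1) ∨ ∃ j : Fin l₂, j < i ∧ f₂ j = J) →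
      (∃ i : Fin l₂, f₂ i = Finset.univ.filter fun x : Fin (n' + n') => n' ≤ x.val) →
      ∃ (l : ℕ) (f : Fin l → Finset (Fin (n + n))), l ≤ l₁ + l₂ ∧
        (∀ i : Fin l, ∃ p ∈ f i, ∃ q ∈ f i, p ≠ q ∧ ∃ u ∉ f i, ∃ v ∉ f i, u ≠ v ∧ ∀ J ∈ [insert u ((f i).erase p), insert v ((f i).erase p), insert u ((f i).erase q), insert v ((f i).erase q), insert u (insert v (((f i).erase p).erase q))], (J.card = n ∧ (J.filter fun x : Fin (n + n) => n ≤ x.val).card ≤ 1) ∨ ∃ j : Fin l, j < i ∧ f j = J) ∧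
        ∃ i : Fin l, f i = Finset.univ.filter fun x : Fin (n + n) => n ≤ x.val)
    (h₃ : ∀ n : ℕ, 2 ≤ n → ∃ (l : ℕ) (f : Fin l → Finset (Fin (n + n))), l ≤ n ^ 3 ∧
      (∀ i : Fin l, ∃ p ∈ f i, ∃ q ∈ f i, p ≠ q ∧ ∃ u ∉ f i, ∃ v ∉ f i, u ≠ v ∧ ∀ J ∈ [insert u ((f i).erase p), insert v ((f i).erase p), insert u ((f i).erase q), insert v ((f i).erase q), insert u (insert v (((f i).erase p).erase q))], (J.card = n ∧ (J.filter fun x : Fin (n + n) => n ≤ x.val).card ≤ 1) ∨ ∃ j : Fin l, j < i ∧ f j = J) ∧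
      ∃ i : Fin l, f i = Finset.univ.filter fun x : Fin (n + n) => n ≤ x.val) :
    TransportToTight :=
  fun h₁ => TightCondensation_of h₁ h₂ h₃

/-- **`TightToShort` (support item stmt-MatrixMultiplication-15942, `TightCondensation → ShortCondensation`),
proved BY NAME**: a tight derivation is a short one with `m' = n ≤ n ^ 1` auxiliary width; the targets
`{n ≤ x}` and `{n ≤ x < 2n}` coincide on `Fin (n + n)`.  (A prover may lift this verbatim into
`Theorems/`; here it is the last link of the skeleton.) [folklore] -/
theorem TightToShort_holds : TightToShort := by
  intro hT ε hε
  obtain ⟨n₀, hn₀⟩ := hT ε hε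
  refine ⟨1, n₀, fun n hn => ⟨n, le_rfl, by simp, ?_⟩⟩
  obtain ⟨l, f, hl, hv, i, hi⟩ := hn₀ n hn
  refine ⟨l, f, hl, hv, i, ?_⟩
  rw [hi]
  refine Finset.filter_congr fun x _ => ⟨fun h => ⟨h, ?_⟩, fun h => h.1⟩
  have hx := x.isLt
  omega

/-! ## The composition: the three stub statements prove the crux BY NAME -/

/-- **THE SKELETON THEOREM.** The crux
`Summit.MatrixMultiplication.MatrixMultiplication.Theses.CondensationDistance.ShortCondensation`
(stmt-MatrixMultiplication-15936) from the three stub STATEMENTS as hypotheses: engine (stub 1) +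
single-scale transport (stub 2) + Dodgson floor (stub 3) ⟹ `TightCondensation` (the recursion,
`TightCondensation_of`) ⟹ `ShortCondensation` (`TightToShort_holds`).  Sorry-free. [folklore] -/
theorem ShortCondensation_of :
    (∀ ε : ℝ, 0 < ε → ∃ n₀ : ℕ, ∀ n ≥ n₀, ∃ (l : ℕ) (f : Fin l → Finset (Fin (n + n))), (l : ℝ) ≤ (n : ℝ) ^ (2 + ε) ∧ (∀ i : Fin l, ∃ p ∈ f i, ∃ q ∈ f i, p ≠ q ∧ ∃ u ∉ f i, ∃ v ∉ f i, u ≠ v ∧ ∀ J ∈ [insert u ((f i).erase p), insert v ((f i).erase p), insert u ((f i).erase q), insert v ((f i).erase q), insert u (insert v (((f i).erase p).erase q))], (J.card = n ∧ (J.filter fun x : Fin (n + n) => n ≤ x.val).card ≤ 1) ∨ ∃ j : Fin l, j < i ∧ f j = J) ∧ ∀ J : Finset (Fin (n + n)), J.card = n → (J \ (Finset.univ.filter fun x : Fin (n + n) => n / 2 ≤ x.val ∧ x.val < n + n / 2)).card ≤ 1 → (J.card = n ∧ (J.filter fun x : Fin (n + n) => n ≤ x.val).card ≤ 1) ∨ ∃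 i : Fin l, f i = J) →
    (∀ (n k n' : ℕ), k + n' = n →
      ∀ (l₁ : ℕ) (f₁ : Fin l₁ → Finset (Fin (n + n))) (l₂ : ℕ) (f₂ : Fin l₂ → Finset (Fin (n' + n'))),
      (∀ i : Fin l₁, ∃ p ∈ f₁ i, ∃ q ∈ f₁ i, p ≠ q ∧ ∃ u ∉ f₁ i, ∃ v ∉ f₁ i, u ≠ v ∧ ∀ J ∈ [insert u ((f₁ i).erase p), insert v ((f₁ i).erase p), insert u ((f₁ i).erase q), insert v ((f₁ i).erase q), insert u (insert v (((f₁ i).erase p).erase q))], (J.card = n ∧ (J.filter fun x : Fin (n + n) => n ≤ x.val).card ≤ 1) ∨ ∃ j : Fin l₁, j < i ∧ f₁ j = J) →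
      (∀ J : Finset (Fin (n + n)), J.card = n → (J \ (Finset.univ.filter fun x : Fin (n + n) => k ≤ x.val ∧ x.val < n + k)).card ≤ 1 → (J.card = n ∧ (J.filter fun x : Fin (n + n) => n ≤ x.val).card ≤ 1) ∨ ∃ i : Fin l₁, f₁ i = J) →
      (∀ i : Fin l₂, ∃ p ∈ f₂ i, ∃ q ∈ f₂ i, p ≠ q ∧ ∃ u ∉ f₂ i, ∃ v ∉ f₂ i, u ≠ v ∧ ∀ J ∈ [insert u ((f₂ i).erase p), insert v ((f₂ i).erase p), insert u ((f₂ i).erase q), insert v ((f₂ i).erase q), insert u (insert v (((f₂ i).erase p).erase q))], (J.card = n' ∧ (J.filter fun x : Fin (n' + n') => n' ≤ x.val).card ≤ 1) ∨ ∃ j : Fin l₂, j < i ∧ f₂ j = J) →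
      (∃ i : Fin l₂, f₂ i = Finset.univ.filter fun x : Fin (n' + n') => n' ≤ x.val) →
      ∃ (l : ℕ) (f : Fin l → Finset (Fin (n + n))), l ≤ l₁ + l₂ ∧
        (∀ i : Fin l, ∃ p ∈ f i, ∃ q ∈ f i, p ≠ q ∧ ∃ u ∉ f i, ∃ v ∉ f i, u ≠ v ∧ ∀ J ∈ [insert u ((f i).erase p), insert v ((f i).erase p), insert u ((f i).erase q), insert v ((f i).erase q), insert u (insert v (((f i).erase p).erase q))], (J.card = n ∧ (J.filter fun x : Fin (n + n) => n ≤ x.val).card ≤ 1) ∨ ∃ j : Fin l, j < i ∧ f j = J) ∧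
        ∃ i : Fin l, f i = Finset.univ.filter fun x : Fin (n + n) => n ≤ x.val) →
    (∀ n : ℕ, 2 ≤ n → ∃ (l : ℕ) (f : Fin l → Finset (Fin (n + n))), l ≤ n ^ 3 ∧
      (∀ i : Fin l, ∃ p ∈ f i, ∃ q ∈ f i, p ≠ q ∧ ∃ u ∉ f i, ∃ v ∉ f i, u ≠ v ∧ ∀ J ∈ [insert u ((f i).erase p), insert v ((f i).erase p), insert u ((f i).erase q), insert v ((f i).erase q), insert u (insert v (((f i).erase p).erase q))], (J.card = n ∧ (J.filter fun x : Fin (n + n) => n ≤ x.val).card ≤ 1) ∨ ∃ j : Fin l, j < i ∧ f j = J) ∧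
      ∃ i : Fin l, f i = Finset.univ.filter fun x : Fin (n + n) => n ≤ x.val) →
    Summit.MatrixMultiplication.MatrixMultiplication.Theses.CondensationDistance.ShortCondensation :=
  fun h₁ h₂ h₃ =>
    (show TightCondensation → ShortCondensation from TightToShort_holds) (TightCondensation_of h₁ h₂ h₃)

/-- The crux fed with the three DECLARED stubs (closed only through their `sorry`s; this is the shape
the line's provers discharge stub by stub). [folklore] -/
theorem ShortCondensation_of_stubs :
    Summit.MatrixMultiplication.MatrixMultiplication.Theses.CondensationDistance.ShortCondensation :=
  ShortCondensation_of stub_cheapHalfTransport stub_transportStep stub_dodgsonExists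

end Summit.MatrixMultiplication.MatrixMultiplication.Cruxes.ShortCondensation.Birth
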